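import Summits.KontsevichZagierPeriods.Zeta5Search.LaiSweepShard

/-!
# `κ₃` sweep certificate — shard file 013 of 127 (shards 91–97 of 889)

HONEST FRAMING. Systematic search; no irrationality claim unless certified. This file only checks,
by `decide +kernel`, shards 91–97 of the order-cell sweep of the `κ₃` point `(74, 2180, 444; δ74)`
(engine `LaiSweepEngine`, soundness `LaiSweepJump/Free/Eval/Shard/Kappa3`; a shard is `⟨regime, n,
p, q, p', q', Lo, Up⟩`: `n` cells from `p/q` to `p'/q'` with integer rate sums in `[Lo, Up]`, `K =
128`, `D = 2^40`). It draws NO conclusion: only the capstone `LaiKappa3SweepCert`, which needs all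
127 shard files, does. Kernel cost of this file ≈ 560 cells × 0.3 s.
-/

namespace Summit.KontsevichZagierPeriods.Zeta5Search.Sweep

set_option maxHeartbeats 100000000 in
/-- Shard 91: 80 cells of regime A from `10/417` to `63/2603`.
[cite: Lai2024BallRivoal, §4 Lemma 4.3] -/
theorem shard091 :
    Shard.check 128 (2^40)
      ⟨false, 80, 10, 417, 63, 2603, 56983397653673, 57007090767139⟩ = true := by
  decide +kernel

set_option maxHeartbeats 100000000 in
/-- Shard 92: 80 cells of regime A from `63/2603` to `32/1307`.
[cite: Lai2024BallRivoal, §4 Lemma 4.3] -/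
theorem shard092 :
    Shard.check 128 (2^40)
      ⟨false, 80, 63, 2603, 32, 1307, 71027095439949, 71059776609418⟩ = true := by
  decide +kernel

set_option maxHeartbeats 100000000 in
/-- Shard 93: 80 cells of regime A from `32/1307` to `62/2509`.
[cite: Lai2024BallRivoal, §4 Lemma 4.3] -/
theorem shard093 :
    Shard.check 128 (2^40)
      ⟨false, 80, 32, 1307, 62, 2509, 56030529574745, 56053938226913⟩ = true := by
  decide +kernel

set_option maxHeartbeats 100000000 in
/-- Shard 94: 80 cells of regime A from `62/2509` to `55/2202`.
[cite: Lai2024BallRivoal, §4 Lemma 4.3] -/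
theorem shard094 :
    Shard.check 128 (2^40)
      ⟨false, 80, 62, 2509, 55, 2202, 63768546858995, 63798763379032⟩ = true := by
  decide +kernel

set_option maxHeartbeats 100000000 in
/-- Shard 95: 80 cells of regime A from `55/2202` to `58/2299`.
[cite: Lai2024BallRivoal, §4 Lemma 4.3] -/
theorem shard095 :
    Shard.check 128 (2^40)
      ⟨false, 80, 55, 2202, 58, 2299, 59120948284862, 59150861399706⟩ = true := by
  decide +kernel

set_option maxHeartbeats 100000000 in
/-- Shard 96: 80 cells of regime A from `58/2299` to `33/1295`.
[cite: Lai2024BallRivoal, §4 Lemma 4.3] -/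
theorem shard096 :
    Shard.check 128 (2^40)
      ⟨false, 80, 58, 2299, 33, 1295, 60620564128881, 60647886986348⟩ = true := by
  decide +kernel

set_option maxHeartbeats 100000000 in
/-- Shard 97: 80 cells of regime A from `33/1295` to `67/2606`.
[cite: Lai2024BallRivoal, §4 Lemma 4.3] -/
theorem shard097 :
    Shard.check 128 (2^40)
      ⟨false, 80, 33, 1295, 67, 2606, 56037885862386, 56064365842451⟩ = true := by
  decide +kernel

/-- The checked shards of this file, in order. [folklore] -/
def shards013 : List (CheckedShard 128 (2^40)) :=
  [⟨_, shard091⟩, ⟨_, shard092⟩, ⟨_, shard093⟩, ⟨_, shard094⟩, ⟨_, shard095⟩,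
    ⟨_, shard096⟩, ⟨_, shard097⟩]

end Summit.KontsevichZagierPeriods.Zeta5Search.Sweep
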